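import Summits.QuantumFields.YangMills.Theorems.BalabanUVNodesN15TwoSpacingGluingCurvedCoverDefectRows
import Summits.QuantumFields.YangMills.Theorems.BalabanUVNodesN15TwoSpacingGluingNeumannRemainderDefect
import Summits.QuantumFields.YangMills.Theorems.BalabanUVNodesN15TwoSpacingGluingAveragingDefect
import HarnessLib

/-!
# THE GLUING STEP AT TWO LATTICE SPACINGS — (Γ15b) THE LIVE-`U` KNIT AT THE COVER, TWO GRIDS, V: dag-n15-a's CUBE-CUT DEFECT ROWS (N-IIc ∕ N-IIe ∕ N-IIh) and NONLOCAL DEFECT ROW (FILE 99)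
# READ ON THE COVER's CUBES `knitG`, the lifted partition quotient bounds, and the real-arithmetic letters of 53 at the cover (dag-n15-c g15, FILE 122b; N15 = NE2, s1 «background-layer
# OPERATOR ingredient»)

Cell `pub-ymgap`, seat `pub-ymgap-dag-n15-c` (R134 (a); HUMAN RULING D-0062), generation 15.  `bears_on: R4∕N15 · K3⁸ SpineGivenEndpointR13SepCoPHV (stmt-QuantumFields-27366)`.
Filed `--kind proof --supports stmt-QuantumFields-27366 --as helper` — COUNT-NEUTRAL.  Theorems only; 0 `def`, 0 `sorry`.  Imports BY NAME FILE 122 `…CurvedCoverDefectRows`, FILE 77 `…NeumannRemainderDefect` (`rpow_sixteenth_facts`; through it dag-n15-a `hasMaj_idef_chiCube_neumannCubeG` ∕ `…_grad_…` ∕ `…_divAdjOut_…`, `symbOp_sD_eq`,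
`bgrad_eq_neg_symbOp`, `hasMaj_rate_le`), FILE 99 `…AveragingDefect` (`hasMaj_idef_nonlocal_family`).  Nothing in the tree is modified.

* §1 `hasMaj_idef_cut_knitG_of` ∕ `hasMaj_idef_cutF_knitG_of` ∕ `hasMaj_idef_cutB_knitG_of` — dag-n15-a's three cube-cut defect rows (side `L^{m+1}`, exponent `−(1∕8)∕2`, rates `δ_c, δ_e, δ_h`,
  `symbOp` currency) RESHAPED to the cover's cube `knitG … k` (side `L·L^m`, exponent `−1∕16`, a common rate `δ ≤ δ_•`, `fgrad`∕`bgrad` currency, constant `max m_e m_h`): the inputs of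
  FILE 121 `hasMaj_idef_cut(F∕B)_cover_lift`.  `hasMaj_idef_nonlocal_cover_of` — FILE 99's row reshaped likewise (input of FILES 121 §3 ∕ 122 §1).
* §2 `abs_fgrad_coverH_lift_le` ∕ `abs_bgrad_coverH_lift_le` ∕ `abs_fgradAdj_fgrad_coverH_lift_le` — FILE 67's partition quotient bounds on the coloured carrier (53's `hh1 hh1b hh2`, both grids).
* §3 `cv_q₀_le`, `cv_θ_small`, `cv_εT_le`, `cv_rN_le`, `cv_rF_le` — the real arithmetic of 53's letters at the cover (`q₀ ≤ ½`, far letter `≤ ¼`, tail letter `≤ κ_T∕w`, the `κ·S` bounds of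
  the two-grid letters `r_N`, `r_F` of FILES 121 §3 ∕ 122 §1).

HONEST FRAMING ∕ LIMITS.  Bookkeeping over LANDED rows on MODEL carriers + real arithmetic; no new analytic estimate; nothing of [B5]∕[B6]∕[B9] asserted (Thm 3.14 pp.426–427 = difference
TEMPLATE; (2.133)–(2.135) p.247 shapes).  NE2⁺ NOT PRINTED, NOT proved; N15 NOT discharged; K3⁸ OPEN, skeleton v6 untouched; counts of record UNMOVED (typed 28∕28 · discharged 5∕27);
one finite 𝕋⁴ at fixed ε — NOT infinite volume, NOT OS on ℝ⁴, NOT a mass gap, NOT Clay; R4 closes the conditional finite-𝕋⁴ rung `BalabanLadder.UV` only.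
-/

noncomputable section

namespace Summit.QuantumFields.YangMills.BalabanUVNodes.N15.Gluing

open Real
open Literature.MathematicalPhysics.QuantumFieldTheory.Balaban1983to89
open Literature.MathematicalPhysics.QuantumFieldTheory.Balaban1983to89.B5Prop11Plancherel (Tor fine)
open Literature.MathematicalPhysics.QuantumFieldTheory.Balaban1983to89.B11SectG (BlockNorm HasMaj)
open Literature.MathematicalPhysics.QuantumFieldTheory.Balaban1983to89.T4EtaRateDefect (idef)
open Literature.MathematicalPhysics.QuantumFieldTheory.Balaban1983to89.T4EtaRateCoeffDefect (pull)
open Literature.MathematicalPhysics.QuantumFieldTheory.Balaban1983to89.B6Prop26Gluing (mulOp ind ind_nonneg)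
open Literature.MathematicalPhysics.QuantumFieldTheory.Balaban1983to89.B6UnitTorusCarrier (unitTorusGeo)
open Literature.MathematicalPhysics.QuantumFieldTheory.Balaban1983to89.B5SiteBridgeP12 (MP)
open Literature.MathematicalPhysics.QuantumFieldTheory.King1986.Torus (blockOf tdistT tdistT_nonneg)
open Summit.QuantumFields.YangMills.BalabanUVNodes.N15.VectorPiece (bshiftEquiv kingPrV blkFine)
open Summit.QuantumFields.YangMills.BalabanUVNodes.N15.BackgroundLayer (fgrad fgradAdj bgrad fgrad_apply fgradAdj_apply bgrad_apply symbOp_sD_eq)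
open Summit.QuantumFields.YangMills.BalabanUVNodes.N15.MatrixSpecies (liftEquiv liftEquiv_apply liftEquiv_symm_apply)
open Summit.QuantumFields.YangMills.BalabanUVNodes.N15.TwoGrid (symbOp sD sTinv paramsOf neumannCubeG chiCube cubeBlocks landauRe qvRe qvAdjRe)

variable {d : ℕ}

/-! ## §1 dag-n15-a's cube-cut defect rows and FILE 99's nonlocal defect row, reshaped to the cover's cubes -/

section Cubes

variable {L : ℕ} [NeZero L] (mv kk r : ℕ) (hL : Odd L ∧ 1 < L) (a : ℝ)

/-- ★★ dag-n15-a N-IIc `hasMaj_idef_chiCube_neumannCubeG` (at `γ = 1∕8`, side `L^{m+1}`, rate `δ_c`) reshaped: the cube-cut defect row of the cover's cube `knitG … k` at any rate `δ ≤ δ_c`,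
exponent `−1∕16` — the input of FILE 121 `hasMaj_idef_cut_cover_lift`. [cite: Balaban1985BackgroundPropagators, Thm 3.14 pp.426–427 (template); Balaban1984PropagatorsII, (2.133) p.247] -/
theorem hasMaj_idef_cut_knitG_of {δc mc δ : ℝ} (hmc : 0 ≤ mc) (hδ : δ ≤ δc) (k : Fin (d + 1) → ZMod (2 * L))
    (h : HasMaj (BlockNorm.ofBlocks (unitTorusGeo L kk (cvM d L mv kk hL)) (blkFine L kk (cvM d L mv kk hL)))
      (BlockNorm.ofBlocks (unitTorusGeo L kk (cvM d L mv kk hL)) (fun i : (Tor (fine (L ^ r * L ^ kk) (cvM d L mv kk hL)) × Fin (d + 1)) => blockOf (L ^ r * L ^ kk) (cvM d L mv kk hL) i.1))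
      (idef (pull (kingPrV L kk r (cvM d L mv kk hL))) (pull (kingPrV L kk r (cvM d L mv kk hL)))
        (mulOp (chiCube (cvM d L mv kk hL) (L ^ r * L ^ kk) (coverCorner (cvM d L mv kk hL) (L ^ mv) L (coverMargin L mv) k) (L ^ (mv + 1))) ∘ₗ
          neumannCubeG (cvM d L mv kk hL) (L ^ r * L ^ kk) (coverCorner (cvM d L mv kk hL) (L ^ mv) L (coverMargin L mv) k) (L ^ (mv + 1)) a)
        (mulOp (chiCube (cvM d L mv kk hL) (L ^ kk) (coverCorner (cvM d L mv kk hL) (L ^ mv) L (coverMargin L mv) k) (L ^ (mv + 1))) ∘ₗ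
          neumannCubeG (cvM d L mv kk hL) (L ^ kk) (coverCorner (cvM d L mv kk hL) (L ^ mv) L (coverMargin L mv) k) (L ^ (mv + 1)) a))
      (fun y y' => ind ((cubeBlocks (cvM d L mv kk hL) (coverCorner (cvM d L mv kk hL) (L ^ mv) L (coverMargin L mv) k) (L ^ (mv + 1)) : Finset _) : Set _) y *
        ind ((cubeBlocks (cvM d L mv kk hL) (coverCorner (cvM d L mv kk hL) (L ^ mv) L (coverMargin L mv) k) (L ^ (mv + 1)) : Finset _) : Set _) y' *
        (mc * ((L ^ kk : ℕ) : ℝ) ^ (-(1 / 8 / 2 : ℝ)) * Real.exp (-(δc * tdistT (cvM d L mv kk hL) y y'))))) :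
    HasMaj (BlockNorm.ofBlocks (unitTorusGeo L kk (cvM d L mv kk hL)) (fun b : CvX d L mv kk hL => blockOf (L ^ kk) (cvM d L mv kk hL) b.1))
      (BlockNorm.ofBlocks (unitTorusGeo L kk (cvM d L mv kk hL)) (fun i : (Tor (fine (L ^ r * L ^ kk) (cvM d L mv kk hL)) × Fin (d + 1)) => blockOf (L ^ r * L ^ kk) (cvM d L mv kk hL) i.1))
      (idef (pull (kingPrV L kk r (cvM d L mv kk hL))) (pull (kingPrV L kk r (cvM d L mv kk hL)))
        (mulOp (chiCube (cvM d L mv kk hL) (L ^ r * L ^ kk) (coverCorner (cvM d L mv kk hL) (L ^ mv) L (coverMargin L mv) k) (L * L ^ mv)) ∘ₗ knitG d L mv kk (L ^ r * L ^ kk) hL a k)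
        (mulOp (chiCube (cvM d L mv kk hL) (L ^ kk) (coverCorner (cvM d L mv kk hL) (L ^ mv) L (coverMargin L mv) k) (L * L ^ mv)) ∘ₗ knitG d L mv kk (L ^ kk) hL a k))
      (fun y y' => ind (g := unitTorusGeo L kk (cvM d L mv kk hL)) (cvSk d L mv kk hL k) y * ind (g := unitTorusGeo L kk (cvM d L mv kk hL)) (cvSk d L mv kk hL k) y' *
        (mc * ((L ^ kk : ℕ) : ℝ) ^ (-(1 / 16 : ℝ)) * Real.exp (-(δ * tdistT (cvM d L mv kk hL) y y')))) := by
  rw [show L ^ (mv + 1) = L * L ^ mv by rw [pow_succ, mul_comm], show (-((1 : ℝ) / 8 / 2)) = -(1 / 16 : ℝ) by norm_num] at h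
  exact hasMaj_rate_le (fun y y' => mul_nonneg (ind_nonneg _ _) (ind_nonneg _ _)) (mul_nonneg hmc (Real.rpow_nonneg (Nat.cast_nonneg _) _)) hδ h

/-- ★★ dag-n15-a N-IIe `hasMaj_idef_chiCube_grad_neumannCubeG` reshaped: the forward-gradient cube-cut defect row of the cover's cube in `fgrad` currency (FILE `symbOp_sD_eq`), side `L·L^m`,
rate `δ ≤ δ_e`, constant `max m_e m_h` — the input of FILE 121 `hasMaj_idef_cutF_cover_lift`. [cite: Balaban1985BackgroundPropagators, Thm 3.14 pp.426–427 (template); Balaban1984PropagatorsII, (2.133) p.247] -/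
theorem hasMaj_idef_cutF_knitG_of {δe me mh δ : ℝ} (hme : 0 ≤ me) (hδ : δ ≤ δe) (k : Fin (d + 1) → ZMod (2 * L)) (μ : Fin (d + 1))
    (h : HasMaj (BlockNorm.ofBlocks (unitTorusGeo L kk (cvM d L mv kk hL)) (blkFine L kk (cvM d L mv kk hL)))
      (BlockNorm.ofBlocks (unitTorusGeo L kk (cvM d L mv kk hL)) (fun i : (Tor (fine (L ^ r * L ^ kk) (cvM d L mv kk hL)) × Fin (d + 1)) => blockOf (L ^ r * L ^ kk) (cvM d L mv kk hL) i.1))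
      (idef (pull (kingPrV L kk r (cvM d L mv kk hL))) (pull (kingPrV L kk r (cvM d L mv kk hL)))
        (mulOp (chiCube (cvM d L mv kk hL) (L ^ r * L ^ kk) (coverCorner (cvM d L mv kk hL) (L ^ mv) L (coverMargin L mv) k) (L ^ (mv + 1))) ∘ₗ
          symbOp (cvM d L mv kk hL) (L ^ r * L ^ kk) (sD (cvM d L mv kk hL) (L ^ r * L ^ kk) μ ((L ^ r * L ^ kk : ℕ) : ℝ)) ∘ₗ
            neumannCubeG (cvM d L mv kk hL) (L ^ r * L ^ kk) (coverCorner (cvM d L mv kk hL) (L ^ mv) L (coverMargin L mv) k) (L ^ (mv + 1)) a)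
        (mulOp (chiCube (cvM d L mv kk hL) (L ^ kk) (coverCorner (cvM d L mv kk hL) (L ^ mv) L (coverMargin L mv) k) (L ^ (mv + 1))) ∘ₗ
          symbOp (cvM d L mv kk hL) (L ^ kk) (sD (cvM d L mv kk hL) (L ^ kk) μ ((L ^ kk : ℕ) : ℝ)) ∘ₗ
            neumannCubeG (cvM d L mv kk hL) (L ^ kk) (coverCorner (cvM d L mv kk hL) (L ^ mv) L (coverMargin L mv) k) (L ^ (mv + 1)) a))
      (fun y y' => ind ((cubeBlocks (cvM d L mv kk hL) (coverCorner (cvM d L mv kk hL) (L ^ mv) L (coverMargin L mv) k) (L ^ (mv + 1)) : Finset _) : Set _) y *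
        ind ((cubeBlocks (cvM d L mv kk hL) (coverCorner (cvM d L mv kk hL) (L ^ mv) L (coverMargin L mv) k) (L ^ (mv + 1)) : Finset _) : Set _) y' *
        (me * ((L ^ kk : ℕ) : ℝ) ^ (-(1 / 16 : ℝ)) * Real.exp (-(δe * tdistT (cvM d L mv kk hL) y y'))))) :
    HasMaj (BlockNorm.ofBlocks (unitTorusGeo L kk (cvM d L mv kk hL)) (fun b : CvX d L mv kk hL => blockOf (L ^ kk) (cvM d L mv kk hL) b.1))
      (BlockNorm.ofBlocks (unitTorusGeo L kk (cvM d L mv kk hL)) (fun i : (Tor (fine (L ^ r * L ^ kk) (cvM d L mv kk hL)) × Fin (d + 1)) => blockOf (L ^ r * L ^ kk) (cvM d L mv kk hL) i.1))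
      (idef (pull (kingPrV L kk r (cvM d L mv kk hL))) (pull (kingPrV L kk r (cvM d L mv kk hL)))
        (mulOp (chiCube (cvM d L mv kk hL) (L ^ r * L ^ kk) (coverCorner (cvM d L mv kk hL) (L ^ mv) L (coverMargin L mv) k) (L * L ^ mv)) ∘ₗ
          (fgrad ((L ^ r * L ^ kk : ℕ) : ℝ) (bshiftEquiv (cvM d L mv kk hL) (L ^ r * L ^ kk) μ) ∘ₗ knitG d L mv kk (L ^ r * L ^ kk) hL a k))
        (mulOp (chiCube (cvM d L mv kk hL) (L ^ kk) (coverCorner (cvM d L mv kk hL) (L ^ mv) L (coverMargin L mv) k) (L * L ^ mv)) ∘ₗ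
          (fgrad ((L ^ kk : ℕ) : ℝ) (bshiftEquiv (cvM d L mv kk hL) (L ^ kk) μ) ∘ₗ knitG d L mv kk (L ^ kk) hL a k)))
      (fun y y' => ind (g := unitTorusGeo L kk (cvM d L mv kk hL)) (cvSk d L mv kk hL k) y * ind (g := unitTorusGeo L kk (cvM d L mv kk hL)) (cvSk d L mv kk hL k) y' *
        (max me mh * ((L ^ kk : ℕ) : ℝ) ^ (-(1 / 16 : ℝ)) * Real.exp (-(δ * tdistT (cvM d L mv kk hL) y y')))) := by
  have hε0 : 0 ≤ ((L ^ kk : ℕ) : ℝ) ^ (-(1 / 16 : ℝ)) := Real.rpow_nonneg (Nat.cast_nonneg _) _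
  rw [show L ^ (mv + 1) = L * L ^ mv by rw [pow_succ, mul_comm], symbOp_sD_eq, symbOp_sD_eq] at h
  exact (hasMaj_rate_le (fun y y' => mul_nonneg (ind_nonneg _ _) (ind_nonneg _ _)) (mul_nonneg hme hε0) hδ h).mono fun y y' =>
    mul_le_mul_of_nonneg_left (mul_le_mul_of_nonneg_right (mul_le_mul_of_nonneg_right (le_max_left _ _) hε0) (Real.exp_nonneg _)) (mul_nonneg (ind_nonneg _ _) (ind_nonneg _ _))

/-- ★★ dag-n15-a N-IIh `hasMaj_idef_chiCube_divAdjOut_neumannCubeG` reshaped: the backward-gradient cube-cut defect row of the cover's cube in `bgrad` currency (`bgrad_eq_neg_symbOp`,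
`idef_neg`), side `L·L^m`, rate `δ ≤ δ_h`, constant `max m_e m_h` — the input of FILE 121 `hasMaj_idef_cutB_cover_lift`. [cite: Balaban1985BackgroundPropagators, Thm 3.14 pp.426–427 (template); Balaban1984PropagatorsII, (2.133) p.247] -/
theorem hasMaj_idef_cutB_knitG_of {δh me mh δ : ℝ} (hmh : 0 ≤ mh) (hδ : δ ≤ δh) (k : Fin (d + 1) → ZMod (2 * L)) (μ : Fin (d + 1))
    (h : HasMaj (BlockNorm.ofBlocks (unitTorusGeo L kk (cvM d L mv kk hL)) (blkFine L kk (cvM d L mv kk hL)))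
      (BlockNorm.ofBlocks (unitTorusGeo L kk (cvM d L mv kk hL)) (fun i : (Tor (fine (L ^ r * L ^ kk) (cvM d L mv kk hL)) × Fin (d + 1)) => blockOf (L ^ r * L ^ kk) (cvM d L mv kk hL) i.1))
      (idef (pull (kingPrV L kk r (cvM d L mv kk hL))) (pull (kingPrV L kk r (cvM d L mv kk hL)))
        (mulOp (chiCube (cvM d L mv kk hL) (L ^ r * L ^ kk) (coverCorner (cvM d L mv kk hL) (L ^ mv) L (coverMargin L mv) k) (L ^ (mv + 1))) ∘ₗ
          symbOp (cvM d L mv kk hL) (L ^ r * L ^ kk) (((L ^ r * L ^ kk : ℕ) : ℝ) • (sTinv (cvM d L mv kk hL) (L ^ r * L ^ kk) μ - 1)) ∘ₗ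
            neumannCubeG (cvM d L mv kk hL) (L ^ r * L ^ kk) (coverCorner (cvM d L mv kk hL) (L ^ mv) L (coverMargin L mv) k) (L ^ (mv + 1)) a)
        (mulOp (chiCube (cvM d L mv kk hL) (L ^ kk) (coverCorner (cvM d L mv kk hL) (L ^ mv) L (coverMargin L mv) k) (L ^ (mv + 1))) ∘ₗ
          symbOp (cvM d L mv kk hL) (L ^ kk) (((L ^ kk : ℕ) : ℝ) • (sTinv (cvM d L mv kk hL) (L ^ kk) μ - 1)) ∘ₗ
            neumannCubeG (cvM d L mv kk hL) (L ^ kk) (coverCorner (cvM d L mv kk hL) (L ^ mv) L (coverMargin L mv) k) (L ^ (mv + 1)) a))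
      (fun y y' => ind ((cubeBlocks (cvM d L mv kk hL) (coverCorner (cvM d L mv kk hL) (L ^ mv) L (coverMargin L mv) k) (L ^ (mv + 1)) : Finset _) : Set _) y *
        ind ((cubeBlocks (cvM d L mv kk hL) (coverCorner (cvM d L mv kk hL) (L ^ mv) L (coverMargin L mv) k) (L ^ (mv + 1)) : Finset _) : Set _) y' *
        (mh * ((L ^ kk : ℕ) : ℝ) ^ (-(1 / 16 : ℝ)) * Real.exp (-(δh * tdistT (cvM d L mv kk hL) y y'))))) :
    HasMaj (BlockNorm.ofBlocks (unitTorusGeo L kk (cvM d L mv kk hL)) (fun b : CvX d L mv kk hL => blockOf (L ^ kk) (cvM d L mv kk hL) b.1))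
      (BlockNorm.ofBlocks (unitTorusGeo L kk (cvM d L mv kk hL)) (fun i : (Tor (fine (L ^ r * L ^ kk) (cvM d L mv kk hL)) × Fin (d + 1)) => blockOf (L ^ r * L ^ kk) (cvM d L mv kk hL) i.1))
      (idef (pull (kingPrV L kk r (cvM d L mv kk hL))) (pull (kingPrV L kk r (cvM d L mv kk hL)))
        (mulOp (chiCube (cvM d L mv kk hL) (L ^ r * L ^ kk) (coverCorner (cvM d L mv kk hL) (L ^ mv) L (coverMargin L mv) k) (L * L ^ mv)) ∘ₗ
          (bgrad ((L ^ r * L ^ kk : ℕ) : ℝ) (bshiftEquiv (cvM d L mv kk hL) (L ^ r * L ^ kk) μ) ∘ₗ knitG d L mv kk (L ^ r * L ^ kk) hL a k))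
        (mulOp (chiCube (cvM d L mv kk hL) (L ^ kk) (coverCorner (cvM d L mv kk hL) (L ^ mv) L (coverMargin L mv) k) (L * L ^ mv)) ∘ₗ
          (bgrad ((L ^ kk : ℕ) : ℝ) (bshiftEquiv (cvM d L mv kk hL) (L ^ kk) μ) ∘ₗ knitG d L mv kk (L ^ kk) hL a k)))
      (fun y y' => ind (g := unitTorusGeo L kk (cvM d L mv kk hL)) (cvSk d L mv kk hL k) y * ind (g := unitTorusGeo L kk (cvM d L mv kk hL)) (cvSk d L mv kk hL k) y' *
        (max me mh * ((L ^ kk : ℕ) : ℝ) ^ (-(1 / 16 : ℝ)) * Real.exp (-(δ * tdistT (cvM d L mv kk hL) y y')))) := by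
  have hε0 : 0 ≤ ((L ^ kk : ℕ) : ℝ) ^ (-(1 / 16 : ℝ)) := Real.rpow_nonneg (Nat.cast_nonneg _) _
  rw [show L ^ (mv + 1) = L * L ^ mv by rw [pow_succ, mul_comm]] at h
  rw [bgrad_eq_neg_symbOp, bgrad_eq_neg_symbOp, LinearMap.neg_comp, LinearMap.comp_neg, LinearMap.neg_comp, LinearMap.comp_neg, idef_neg]
  exact ((hasMaj_rate_le (fun y y' => mul_nonneg (ind_nonneg _ _) (ind_nonneg _ _)) (mul_nonneg hmh hε0) hδ h).mono fun y y' =>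
    mul_le_mul_of_nonneg_left (mul_le_mul_of_nonneg_right (mul_le_mul_of_nonneg_right (le_max_right _ _) hε0) (Real.exp_nonneg _)) (mul_nonneg (ind_nonneg _ _) (ind_nonneg _ _))).neg

/-- ★ FILE 99 `hasMaj_idef_nonlocal_family` (at `γ = 1∕8`, rate `δ_v`) reshaped: the nonlocal defect row `𝔇_π(N′_L, N_L) ≤ r(L^k)^{−1∕16}e^{−δd}` at any rate `δ ≤ δ_v` — the input `hDN` of
FILES 121 §3 ∕ 122 §1. [cite: Balaban1984PropagatorsI, (1.126)–(1.128) p.38 (shapes); Balaban1985BackgroundPropagators, Thm 3.14 pp.426–427 (template)] -/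
theorem hasMaj_idef_nonlocal_cover_of {δv rr δ : ℝ} (hrr : 0 ≤ rr) (hδ : δ ≤ δv)
    (h : HasMaj (BlockNorm.ofBlocks (unitTorusGeo L kk (cvM d L mv kk hL)) (blkFine L kk (cvM d L mv kk hL)))
      (BlockNorm.ofBlocks (unitTorusGeo L kk (cvM d L mv kk hL)) (fun i : (Tor (fine (L ^ r * L ^ kk) (cvM d L mv kk hL)) × Fin (d + 1)) => blockOf (L ^ r * L ^ kk) (cvM d L mv kk hL) i.1))
      (idef (pull (kingPrV L kk r (cvM d L mv kk hL))) (pull (kingPrV L kk r (cvM d L mv kk hL)))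
        (a • (qvAdjRe (cvM d L mv kk hL) (L ^ r * L ^ kk) ∘ₗ qvRe (cvM d L mv kk hL) (L ^ r * L ^ kk)) + (-landauRe (cvM d L mv kk hL) (L ^ r * L ^ kk)))
        (a • (qvAdjRe (cvM d L mv kk hL) (L ^ kk) ∘ₗ qvRe (cvM d L mv kk hL) (L ^ kk)) + (-landauRe (cvM d L mv kk hL) (L ^ kk))))
      (fun y y' => rr * ((L ^ kk : ℕ) : ℝ) ^ (-(1 / 8 / 2 : ℝ)) * Real.exp (-(δv * tdistT (cvM d L mv kk hL) y y')))) :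
    HasMaj (BlockNorm.ofBlocks (unitTorusGeo L kk (cvM d L mv kk hL)) (fun b : CvX d L mv kk hL => blockOf (L ^ kk) (cvM d L mv kk hL) b.1))
      (BlockNorm.ofBlocks (unitTorusGeo L kk (cvM d L mv kk hL)) (fun i : (Tor (fine (L ^ r * L ^ kk) (cvM d L mv kk hL)) × Fin (d + 1)) => blockOf (L ^ r * L ^ kk) (cvM d L mv kk hL) i.1))
      (idef (pull (kingPrV L kk r (cvM d L mv kk hL))) (pull (kingPrV L kk r (cvM d L mv kk hL)))
        (a • (qvAdjRe (cvM d L mv kk hL) (L ^ r * L ^ kk) ∘ₗ qvRe (cvM d L mv kk hL) (L ^ r * L ^ kk)) + (-landauRe (cvM d L mv kk hL) (L ^ r * L ^ kk)))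
        (a • (qvAdjRe (cvM d L mv kk hL) (L ^ kk) ∘ₗ qvRe (cvM d L mv kk hL) (L ^ kk)) + (-landauRe (cvM d L mv kk hL) (L ^ kk))))
      (fun y y' => rr * ((L ^ kk : ℕ) : ℝ) ^ (-(1 / 16 : ℝ)) * Real.exp (-(δ * tdistT (cvM d L mv kk hL) y y'))) := by
  rw [show (-((1 : ℝ) / 8 / 2)) = -(1 / 16 : ℝ) by norm_num] at h
  exact h.mono fun y y' => mul_le_mul_of_nonneg_left (Real.exp_le_exp.mpr (by nlinarith [tdistT_nonneg (cvM d L mv kk hL) y y', hδ]))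
    (mul_nonneg hrr (Real.rpow_nonneg (Nat.cast_nonneg _) _))

end Cubes

/-! ## §2 The partition's quotient bounds on the coloured carrier (53's `hh1`, `hh1b`, `hh2`, both grids) -/

section Quotients

variable {M : Fin (d + 1) → ℕ} [∀ μ, NeZero (M μ)] {n w q : ℕ} [NeZero n] (ι : Type)

/-- ★ `|∇_μ(h_k∘fst)| ≤ π∕w` on the coloured carrier (FILE 67 `abs_fgrad_coverH_le` at `p.1`). [cite: Balaban1984PropagatorsII, (2.36)–(2.37) p.229 (shape)] -/
theorem abs_fgrad_coverH_lift_le (hM : ∀ ν, M ν = 2 * q * w) (hw : 0 < w) (k : Fin (d + 1) → ZMod (2 * q)) (μ : Fin (d + 1)) (p : (Tor (fine n M) × Fin (d + 1)) × ι) :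
    |fgrad (n : ℝ) (liftEquiv (bshiftEquiv M n μ) ι) (fun p : (Tor (fine n M) × Fin (d + 1)) × ι => hcube (2 * q) (coverXi M n w) k p.1) p| ≤ π / w := by
  have h := abs_fgrad_coverH_le hM hw k μ p.1
  simp only [fgrad_apply, liftEquiv_apply] at h ⊢
  exact h

/-- ★ `|∇̄_μ(h_k∘fst)| ≤ π∕w` on the coloured carrier (FILE 67 `abs_bgrad_coverH_le`). [cite: Balaban1984PropagatorsII, (2.36)–(2.37) p.229 (shape)] -/
theorem abs_bgrad_coverH_lift_le (hM : ∀ ν, M ν = 2 * q * w) (hw : 0 < w) (k : Fin (d + 1) → ZMod (2 * q)) (μ : Fin (d + 1)) (p : (Tor (fine n M) × Fin (d + 1)) × ι) :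
    |bgrad (n : ℝ) (liftEquiv (bshiftEquiv M n μ) ι) (fun p : (Tor (fine n M) × Fin (d + 1)) × ι => hcube (2 * q) (coverXi M n w) k p.1) p| ≤ π / w := by
  have h := abs_bgrad_coverH_le hM hw k μ p.1
  simp only [bgrad_apply, liftEquiv_symm_apply] at h ⊢
  exact h

/-- ★ `|∇*_μ∇_μ(h_k∘fst)| ≤ 32π²∕w²` on the coloured carrier (FILE 67 `abs_fgradAdj_fgrad_coverH_le`). [cite: Balaban1984PropagatorsII, (2.36)–(2.37) p.229 (shape)] -/
theorem abs_fgradAdj_fgrad_coverH_lift_le (hM : ∀ ν, M ν = 2 * q * w) (hw : 0 < w) (k : Fin (d + 1) → ZMod (2 * q)) (μ : Fin (d + 1)) (p : (Tor (fine n M) × Fin (d + 1)) × ι) :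
    |fgradAdj (n : ℝ) (liftEquiv (bshiftEquiv M n μ) ι) (fgrad (n : ℝ) (liftEquiv (bshiftEquiv M n μ) ι) (fun p : (Tor (fine n M) × Fin (d + 1)) × ι => hcube (2 * q) (coverXi M n w) k p.1)) p| ≤
      32 * π ^ 2 / (w : ℝ) ^ 2 := by
  have h := abs_fgradAdj_fgrad_coverH_le hM hw k μ p.1
  simp only [fgradAdj_apply, fgrad_apply, liftEquiv_apply, liftEquiv_symm_apply] at h ⊢
  exact h

end Quotients

/-! ## §3 The real arithmetic of 53's letters at the cover -/

section Letters

/-- `q₀ = (β + β₁ + (π∕w)β)·R·c_r² ≤ ½` for `R = 1∕(2(β + β₁ + πβ)c_r² + 1)`, `w ≥ 1`. [folklore] -/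
theorem cv_q₀_le {β β₁ cr R W : ℝ} (hβ : 0 ≤ β) (hβ₁ : 0 ≤ β₁) (hcr : 0 ≤ cr) (hW : 1 ≤ W) (hR : R = 1 / (2 * ((β + (β₁ + π * β)) * cr * cr) + 1)) :
    (β + (β₁ + π / W * β)) * (R * cr) * cr ≤ 1 / 2 := by
  have hR0 : 0 ≤ R := by rw [hR]; positivity
  have hπw : π / W ≤ π := div_le_self pi_pos.le hW
  have h1 : (β + (β₁ + π / W * β)) * (R * cr) * cr ≤ (β + (β₁ + π * β)) * (R * cr) * cr := by
    have := mul_le_mul_of_nonneg_right hπw hβ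
    exact mul_le_mul_of_nonneg_right (mul_le_mul_of_nonneg_right (by linarith only [this]) (by positivity)) hcr
  have h2 : (β + (β₁ + π * β)) * (R * cr) * cr = ((β + (β₁ + π * β)) * cr * cr) / (2 * ((β + (β₁ + π * β)) * cr * cr) + 1) := by rw [hR]; ring
  have h3 : ((β + (β₁ + π * β)) * cr * cr) / (2 * ((β + (β₁ + π * β)) * cr * cr) + 1) ≤ 1 / 2 := by
    rw [div_le_iff₀ (by positivity)]
    have : 0 ≤ (β + (β₁ + π * β)) * cr * cr := by positivity
    linarith only [this]
  linarith only [h1, h2, h3]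

/-- the far letter `θ₀ = 1∕(4N_ov c_r|ι|²·2(β+β₁+πβ)c_r + 4)` makes `N_ov c_r(|ι|²(θ₀·2(β+β₁+πβ)·c_r)) ≤ ¼`. [folklore] -/
theorem cv_θ_small {Nov cr cι2 β β₁ θ₀ : ℝ} (hNov : 0 ≤ Nov) (hcr : 0 ≤ cr) (hcι : 0 ≤ cι2) (hβ : 0 ≤ β) (hβ₁ : 0 ≤ β₁)
    (hθ₀ : θ₀ = 1 / (4 * (Nov * cr * (cι2 * (2 * (β + (β₁ + π * β))) * cr)) + 4)) : Nov * cr * (cι2 * (θ₀ * (2 * (β + (β₁ + π * β))) * cr)) ≤ 1 / 4 := by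
  have hX : 0 ≤ Nov * cr * (cι2 * (2 * (β + (β₁ + π * β))) * cr) := by positivity
  have e1 : Nov * cr * (cι2 * (θ₀ * (2 * (β + (β₁ + π * β))) * cr)) = θ₀ * (Nov * cr * (cι2 * (2 * (β + (β₁ + π * β))) * cr)) := by ring
  rw [e1, hθ₀, div_mul_eq_mul_div, one_mul, div_le_iff₀ (by positivity)]
  linarith only [hX]

/-- the tail letter `ε_T = 2^{d+1}(c_{N,0}e^{−(δ−3δ∕4)w}·Ce^{δ₀}·c_r) ≤ κ_T∕w` with `κ_T = 2^{d+1}(c_{N,0}(4∕δ)Ce^{δ₀}c_r)` (`e^{−x} ≤ x⁻¹`). [folklore] -/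
theorem cv_εT_le {dd : ℕ} {cN₀ δm W C δ₀ cr εT κT : ℝ} (hcN₀ : 0 ≤ cN₀) (hδm : 0 < δm) (hW : 0 < W) (hC : 0 ≤ C) (hcr : 0 ≤ cr)
    (hεT : εT = 2 ^ (dd + 1) * (cN₀ * Real.exp (-((δm - 3 * δm / 4) * W)) * (C * Real.exp δ₀) * cr)) (hκT : κT = 2 ^ (dd + 1) * (cN₀ * (4 / δm) * (C * Real.exp δ₀) * cr)) :
    εT ≤ κT / W := by
  have hx : 0 < δm / 4 * W := by positivity
  have hexp : Real.exp (-((δm - 3 * δm / 4) * W)) ≤ (δm / 4 * W)⁻¹ := by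
    rw [show (δm - 3 * δm / 4) * W = δm / 4 * W by ring, Real.exp_neg]
    exact inv_anti₀ hx (by linarith only [Real.add_one_le_exp (δm / 4 * W)])
  have h1 : εT ≤ 2 ^ (dd + 1) * (cN₀ * (δm / 4 * W)⁻¹ * (C * Real.exp δ₀) * cr) := by
    rw [hεT]
    exact mul_le_mul_of_nonneg_left (mul_le_mul_of_nonneg_right (mul_le_mul_of_nonneg_right (mul_le_mul_of_nonneg_left hexp hcN₀) (by positivity)) hcr) (by positivity)
  have h2 : 2 ^ (dd + 1) * (cN₀ * (δm / 4 * W)⁻¹ * (C * Real.exp δ₀) * cr) = κT / W := by rw [hκT]; field_simp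
  linarith only [h1, h2]

/-- the `κ·S` bound of 53's letter `r_N` at the cover (FILE 121 §3's constant): `(D∕w·E + 2D∕w)(r·ε) + 2(D∕(nw))c ≤ ((DE + 2D)r + 2Dc)·S` for `ε ≤ S`, `(nw)⁻¹ ≤ ε`, `w ≥ 1`. [folklore] -/
theorem cv_rN_le {D E rr cN₀ ε S W n : ℝ} (hD : 0 ≤ D) (hE : 0 ≤ E) (hrr : 0 ≤ rr) (hcN : 0 ≤ cN₀) (hε : 0 ≤ ε) (hεS : ε ≤ S) (hW : 1 ≤ W) (hnW : (n * W)⁻¹ ≤ ε) :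
    (D / W * E + 2 * (D / W)) * (rr * ε) + 2 * (D / (n * W)) * cN₀ ≤ ((D * E + 2 * D) * rr + 2 * D * cN₀) * S := by
  have h1 : D / W ≤ D := div_le_self hD hW
  have h2 : D / W * E + 2 * (D / W) ≤ D * E + 2 * D := add_le_add (mul_le_mul_of_nonneg_right h1 hE) (by linarith only [h1])
  have h3 : rr * ε ≤ rr * S := mul_le_mul_of_nonneg_left hεS hrr
  have h4 : D / (n * W) ≤ D * S := by rw [div_eq_mul_inv]; exact mul_le_mul_of_nonneg_left (hnW.trans hεS) hD
  have h5 : (D / W * E + 2 * (D / W)) * (rr * ε) ≤ (D * E + 2 * D) * (rr * S) := mul_le_mul h2 h3 (by positivity) (by positivity)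
  have h6 : 2 * (D / (n * W)) * cN₀ ≤ 2 * (D * S) * cN₀ := mul_le_mul_of_nonneg_right (mul_le_mul_of_nonneg_left h4 zero_le_two) hcN
  calc (D / W * E + 2 * (D / W)) * (rr * ε) + 2 * (D / (n * W)) * cN₀ ≤ (D * E + 2 * D) * (rr * S) + 2 * (D * S) * cN₀ := add_le_add h5 h6
    _ = ((D * E + 2 * D) * rr + 2 * D * cN₀) * S := by ring

/-- the `κ·S` bound of 53's letter `r_F` at the cover (FILE 122 §1's constant): every summand carries one small factor (`ε`, `C∕n`, `o`) and the damping `X = e^{−(δ∕4)w} ≤ 1` is dropped. [folklore] -/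
theorem cv_rF_le {T A X Dp ε S D1 C n o rr D : ℝ} (hT : 0 ≤ T) (hA : 0 ≤ A) (hX : X ≤ 1) (hDp : 0 ≤ Dp) (hε : 0 ≤ ε) (hεS : ε ≤ S) (hD1 : 0 ≤ D1) (hC : 0 ≤ C)
    (hn0 : 0 < n) (hn : n⁻¹ ≤ ε) (ho0 : 0 ≤ o) (ho : o ≤ D * S) (hrr : 0 ≤ rr) :
    T * (A * X * (Dp * ε) + A * X * (D1 * (C / n)) + (A * o + rr * ε + o * A) * X * C) ≤ (T * (A * Dp + A * (D1 * C) + (A * D + rr + D * A) * C)) * S := by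
  have hS : 0 ≤ S := hε.trans hεS
  have hAX : A * X ≤ A := mul_le_of_le_one_right hA hX
  have t1 : A * X * (Dp * ε) ≤ A * (Dp * S) := mul_le_mul hAX (mul_le_mul_of_nonneg_left hεS hDp) (by positivity) hA
  have hCn : C / n ≤ C * S := by rw [div_eq_mul_inv]; exact mul_le_mul_of_nonneg_left (hn.trans hεS) hC
  have t2 : A * X * (D1 * (C / n)) ≤ A * (D1 * (C * S)) := mul_le_mul hAX (mul_le_mul_of_nonneg_left hCn hD1) (mul_nonneg hD1 (div_nonneg hC hn0.le)) hA
  have h3 : A * o + rr * ε + o * A ≤ A * (D * S) + rr * S + D * S * A :=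
    add_le_add (add_le_add (mul_le_mul_of_nonneg_left ho hA) (mul_le_mul_of_nonneg_left hεS hrr)) (mul_le_mul_of_nonneg_right ho hA)
  have h30 : 0 ≤ A * o + rr * ε + o * A := by positivity
  have t3 : (A * o + rr * ε + o * A) * X * C ≤ (A * (D * S) + rr * S + D * S * A) * C :=
    mul_le_mul_of_nonneg_right ((mul_le_of_le_one_right h30 hX).trans h3) hC
  calc T * (A * X * (Dp * ε) + A * X * (D1 * (C / n)) + (A * o + rr * ε + o * A) * X * C) ≤ T * (A * (Dp * S) + A * (D1 * (C * S)) + (A * (D * S) + rr * S + D * S * A) * C) :=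
        mul_le_mul_of_nonneg_left (add_le_add (add_le_add t1 t2) t3) hT
    _ = (T * (A * Dp + A * (D1 * C) + (A * D + rr + D * A) * C)) * S := by ring

end Letters

end Summit.QuantumFields.YangMills.BalabanUVNodes.N15.Gluing

end
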